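import Summits.QuantumFields.YangMills.Theorems.UnitScaleTiltProp7CubeCutoffFlatness
import Summits.QuantumFields.YangMills.Theorems.UnitScaleTiltProp7LocalProjectorRowCube
import Summits.QuantumFields.YangMills.Theorems.UnitScaleTiltProp7PropagatorComparisonOnCutoff
import Summits.QuantumFields.YangMills.Theorems.UnitScaleTiltProp7TopMeanComparisonOnPropagatorDock
import Summits.QuantumFields.YangMills.Theorems.UnitScaleTiltProp7MassivePropagatorCoercive
import Summits.QuantumFields.YangMills.Theorems.UnitScaleTiltProp7TopMeanFrameRows
import Summits.QuantumFields.YangMills.Theorems.UnitScaleTiltProp7TopMeanFrameWalkLengths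
import Summits.QuantumFields.YangMills.Theorems.UnitScaleTiltProp7TopMeanFrameWalkFlat
import HarnessLib

/-!
# Route `UnitScaleTilt`, crux K1 «MinimiserStabilityRegPr» (stmt-QuantumFields-19200), EX row `hGF[Lift]` (curved member) — LOD LINE, PEN (L5″) `hloc` PER CUBE,
# THE PER-CUBE DISCHARGE, STAGE RB: **THE ROWS `hRB1` AND `hRB2` OF ✓`Prop7LocalProjectorRowCube.hloc_of_cube_rows` AT EVERY CUBE, FROM px5 g11's DOCKS
# ✓`norm_massiveInv_sub_le_of_cutoff_fixed` (RB1) AND ✓`norm_lift_topMean_sub_flat_propagated_le` (RB2)** — for the cube-gauged background `W_c = (axialT U₀ c)·U₀` and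
# `f_c = D*_{W_c}(Ad_{σ_c}X)~`: `‖G_c f_c − G_1 f_c‖ ≤ cG·‖f_c‖` and `‖ι(Q_c(G_1 f_c)) − ι(Q_1(G_1 f_c))‖ ≤ cQ·‖f_c‖`, with `cG`, `cQ` EXPLICIT functions of `(L, K − n, c₀, c₁, a, ν,
# μa, Bt, Rb, ε₀)` only (`K`-free after the pin `c₁ = c₀ℓ³`; `cG` = `O(ν)` cut-off commutator + `O(ε₀Rb)` flatness; `cQ` = `O(ε₀Rb)` + the `e^{−μa(Bt−1)∕ν}` tail)

Cell `ym3-torus` (HUMAN RULING D-0037: YM₃ on T³ is ladder rung R3 — NOT d = 4, NOT infinite volume, NOT a mass gap, NOT Clay).  Width seat `ym-routeR-w3` (gen 13); chair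
★`ym-ust-19200-p1` g25 CHAIR WORD №2 (iii) «GO — routeR-w3 takes the per-cube discharge»; routeR-w2 g13 ✓p760402∕✓p760971 «USE BY NAME (routeR-w3 g13)».  THEOREMS ONLY
(0 `def`, 0 `sorry`); `--supports stmt-QuantumFields-19200 --as helper`, count-neutral.  HONEST LABEL (★★OWNER RULING №33 (6)): a knit of landed rows; CONDITIONAL on the per-cube
letter families `Qc Tc Gc` and the flat letters `Q1 T1 G1` (px10 picks the data of record), `n < K`, the smallness `24ε₀(Rb + 9) ≤ 1`, the no-wrap room, and (RB2 only) the
DISPLAYED window letters `hδw`∕`hwin` at `θ := μa·η`, `θ′ := 3μa`; nothing of `hloc`, `hlarge`, `hT`, `hGF`, EX or the crux is proved here.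

THE KNIT (per cube centre `c`, inside each proof).  `T₀ :=` the blocks within `r` of `S_c = {z | tdist z (B^k c) ≤ 3L^s + 4}`; cut-offs `χ χt χc φ φc` ← ✓p760971 `exists_cubeCutoffs`
(rows (1)–(12)); fine radius `R := (Rb + 6)·L^k` ← STAGE G ✓p761256 `tdist_le_of_cutoff_row` + `tdist_blocks_T₀_le` under `3L^s + 4 + r + Bc∕ν + 3 ≤ Rb`; flatness `hUV`
(`δ ≤ 2ε₀(Rb + 7)`) and `hflat` (`δ′ = 2·regThreshold·(R + 3(L^k − 1)) ≤ 2ε₀η(Rb + 9)`) ← ✓`hUV_cubeGauge`∕`hflat_cubeGauge`; comb frames `hCU` (`≤ 8mδ′ ≤ 48ε₀(Rb + 9)`),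
`hCV = 0` ← ✓`frameRow_of_walkFlat` ∘ ✓`frameWalkLengths` ∘ ✓`walkFlat_of_blockFlat` (`4mδ′ ≤ 24ε₀(Rb+9) ≤ 1`); massive rows at both backgrounds ← §1 below; the cut-off
operator `X_χ` ← ✓`exists_siteMul`; `X_χ f_c = f_c` ← ✓p760402 `dstar_blockSupport` + row (7) (`S_c ⊆ T₀` as `0 < r`); then px5's docks with `V := 1`, `U := W_c`.

WHAT IS PROVED (ns `…Theorems.Prop7LocalProjectorRowsRBOfCube`).
* §1 `coercive_of_massive` ∕ `energy_of_massive` — the two `L²` rows of px5's docks (`C_P⁻²‖u‖² ≤ re⟪u, A_W u⟫`, `C_P² = max 2 (16c₀ℓ³∕(a c₁))`; `‖D_W w‖² ≤ re⟪w, A_W w⟫`)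
  from ✓`Prop7MassivePropagatorCoercive.coercive_massive`∕`re_inner_massive_eq`, any `RegPr` background.
* §2 ★★★ `hRB1_of_cube` — ✓p760402's binder `hRB1` VERBATIM, `cG :=` px5's RB1 constant at `θ := ν·η, θ′ := 3ν, δ := 2ε₀(Rb+7), δV := 0, δU := 48ε₀(Rb+9),
  mU = mV := (max 2 (16c₀ℓ³∕(a c₁)))⁻¹`.
* §2 ★★★ `hRB2_of_cube` — ✓p760402's binder `hRB2` VERBATIM, `cQ := √(2κ)·(9000L²ε₀ + 96ε₀(Rb+9))·C_P² + 2√((25∕8)κ)·e^{−μa(Bt−1)∕ν}·64C_P²`, `κ = c₁(L^{3})^{-(K−n)}∕c₀`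
  (px5's RB2 constant with `16mδ′ ≤ 96ε₀(Rb+9)` and `‖G_1‖ ≤ C_P²` substituted).  HONEST SCOPE: `hop` is the sequel file (STAGE OP).

References: T. Bałaban, CMP **99** (1985) 389–434 [Balaban1985BackgroundPropagators] ((3.20)–(3.26) pp.394–395, (3.49) p.399, (3.105)–(3.106) p.414); CMP **99** (1985) 75–102
[Balaban1985RegularSpaces] (Lemma 1 p.79); CMP **98** (1985) 17–51 [Balaban1985Averaging] ((2) p.17, (97) p.32).
-/

set_option autoImplicit false
noncomputable section

open scoped BigOperators Matrix.Norms.L2Operator InnerProductSpace ComplexConjugate Matrix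

namespace Summit.QuantumFields.YangMills.Theorems.Prop7LocalProjectorRowsRBOfCube

open Literature.MathematicalPhysics.QuantumFieldTheory.Balaban1983to89
open Literature.MathematicalPhysics.QuantumFieldTheory.Balaban1983to89.T3ContinuumYM3Torus
open T4Continuum BlockAveraging
open BlockAveraging (Idx)
open B7Prop1Explicit (disp)
open B5Eq118OneStroke (iterBlockOf iterBlock)
open B10Eq27TorusAxialLog (holT transl axialT)
open B7TransferAnalyticMean (meanCLM)
open B11Eq103H1Complex (SiteL2K)
open B3Taylor310LocalRemainder (tdist_self)
open Summit.QuantumFields.YangMills.Theorems.Prop8Chart (emlIterU)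
open T3SectALandauChart (eta eta_pos bgUnits bgUnits_one)
open T3PrintedRegularMinimiser (RegPr regPr_one)
open T3PrintedRegularOrbits (sites_eq regPr_gaugeAct_iff)
open T3RegularMinimiser (regThreshold regThreshold_pos)
open T3LevelShift (siteShift)
open Summit.QuantumFields.YangMills.Theorems.Prop7SectET3Transport (periodsT3)
open Summit.QuantumFields.YangMills.Theorems.Prop7SectET3HilbertLetters (W₂ toL2 toL2S DL2 DstarL2 covLapSite)
open Summit.QuantumFields.YangMills.Theorems.Prop7BlockDistanceWeights (eta_mul_pow_eq_one)
open Summit.QuantumFields.YangMills.Theorems.Prop7CubeCutoffGeometry (exists_cubeCutoffs)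
open Summit.QuantumFields.YangMills.Theorems.Prop7CubeCutoffFlatness (tdist_le_of_cutoff_row tdist_blocks_T₀_le hUV_cubeGauge hflat_cubeGauge hflat_cubeGauge_of_plateau delta_le_of_radius_le deltaFlat_le_of_radius_le)
open Summit.QuantumFields.YangMills.Theorems.Prop7LocalProjectorRowCube (dstar_blockSupport)
open Summit.QuantumFields.YangMills.Theorems.Prop7PropagatorComparisonOnCutoff (norm_massiveInv_sub_le_of_cutoff_fixed)
open Summit.QuantumFields.YangMills.Theorems.Prop7MassivePropagatorCoercive (coercive_massive re_inner_massive_eq exists_siteMul norm_le_of_massive_eq)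
open Summit.QuantumFields.YangMills.Theorems.Prop7TopMeanComparisonOnPropagatorDock (norm_lift_topMean_sub_flat_propagated_le)
open Summit.QuantumFields.YangMills.Theorems.Prop7TopMeanFrameRows (frameRow_of_walkFlat)
open Summit.QuantumFields.YangMills.Theorems.Prop7TopMeanFrameWalkLengths (frameWalkLengths one_le_frameWalkBound)
open Summit.QuantumFields.YangMills.Theorems.Prop7TopMeanFrameWalkFlat (walkFlat_of_blockFlat)

variable (F : T3Family) {n K : ℕ} (h : n ≤ K) {c₀ c₁ : ℝ} [Fact (0 < c₀)] [Fact (0 < c₁)]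

/-! ## §1 The two `L²` rows of px5's docks at any `RegPr` background, from ✓`Prop7MassivePropagatorCoercive` -/

section MassiveRows

variable {ε₀ : ℝ} (hε₀ : 0 < ε₀) (hε7 : 10 ^ 7 * (F.L : ℝ) ^ 3 * ε₀ ≤ 1)
  (W : GaugeField (F.P K) 0 (Matrix.specialUnitaryGroup (Fin 2) ℂ)) (hregW : RegPr F n K ε₀ W)
  (QW : SiteL2K ℂ 3 (periodsT3 F K) c₀ W₂ →ₗ[ℂ] (Site (F.P K) (K - n) → Matrix (Fin 2) (Fin 2) ℂ))
  (hseqW : (∀ lam : Site (F.P K) 0 → Matrix (Fin 2) (Fin 2) ℂ, ∃ ns : (j : ℕ) → Site (F.P K) j → Matrix (Fin 2) (Fin 2) ℂ, ns 0 = lam ∧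
        (∀ (j : ℕ) (y : Site (F.P K) (j + 1)), ns (j + 1) y = ns j (emb y) - meanCLM (Idx (F.P K)) (Matrix (Fin 2) (Fin 2) ℂ) fun i : Idx (F.P K) =>
          ns j (emb y) - ((holT (emlIterU j (bgUnits F K W)) (emb y) (stairWord i.2.1 (off i.1)) : (Matrix (Fin 2) (Fin 2) ℂ)ˣ) : Matrix (Fin 2) (Fin 2) ℂ) *
            ns j (transl (emb y) (disp (stairWord i.2.1 (off i.1)))) * (((holT (emlIterU j (bgUnits F K W)) (emb y) (stairWord i.2.1 (off i.1)))⁻¹ : (Matrix (Fin 2) (Fin 2) ℂ)ˣ) : Matrix (Fin 2) (Fin 2) ℂ)) ∧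
        ns (K - n) = QW (toL2S F K c₀ lam)))
  (ι : (Site (F.P K) (K - n) → Matrix (Fin 2) (Fin 2) ℂ) →ₗ[ℂ] SiteL2K ℂ 3 (periodsT3 F n) c₁ W₂)
  (hι : ∀ c, ι c = toL2S F n c₁ (fun z => c (siteShift (sites_eq F n K h) z)))
  (TW : SiteL2K ℂ 3 (periodsT3 F n) c₁ W₂ →ₗ[ℂ] SiteL2K ℂ 3 (periodsT3 F K) c₀ W₂)
  (hTW : ∀ (l : SiteL2K ℂ 3 (periodsT3 F K) c₀ W₂) (f : SiteL2K ℂ 3 (periodsT3 F n) c₁ W₂), ⟪ι (QW l), f⟫_ℂ = ⟪l, TW f⟫_ℂ)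
  {a : ℝ} (ha : 0 < a)
  (AW : SiteL2K ℂ 3 (periodsT3 F K) c₀ W₂ →ₗ[ℂ] SiteL2K ℂ 3 (periodsT3 F K) c₀ W₂) (hAW : ∀ w, AW w = covLapSite F n K c₀ W w + (a : ℂ) • TW (ι (QW w)))

include h hε₀ hε7 hregW hseqW hι ha hTW hAW in
/-- **COERCIVITY ROW** of px5's docks: `C_P⁻²·‖u‖² ≤ re⟪u, A_W u⟫`, `C_P² = max 2 (16c₀ℓ³∕(a c₁))` (✓`coercive_massive` + ✓`re_inner_massive_eq`).
[cite: Balaban1985BackgroundPropagators, (3.24) p.394, Thm 3.11 p.416] -/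
theorem coercive_of_massive (u : SiteL2K ℂ 3 (periodsT3 F K) c₀ W₂) :
    (max 2 (16 * c₀ * ((F.L : ℝ) ^ (K - n)) ^ 3 / (a * c₁)))⁻¹ * ‖u‖ ^ 2 ≤ RCLike.re ⟪u, AW u⟫_ℂ := by
  have hC : (0 : ℝ) < max 2 (16 * c₀ * ((F.L : ℝ) ^ (K - n)) ^ 3 / (a * c₁)) := lt_of_lt_of_le (by norm_num) (le_max_left _ _)
  rw [hAW, re_inner_massive_eq F W QW ι TW hTW (a := a) u]
  have hco := coercive_massive F h hε₀ hε7 W hregW QW hseqW ι hι ha u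
  rw [inv_mul_le_iff₀ hC]
  exact hco

include hTW hAW in
/-- **ENERGY ROW** of px5's docks: `‖D_W w‖² ≤ re⟪w, A_W w⟫` (✓`re_inner_massive_eq`, `a ≥ 0`). [cite: Balaban1985BackgroundPropagators, (3.24) p.394] -/
theorem energy_of_massive (ha' : 0 ≤ a) (w : SiteL2K ℂ 3 (periodsT3 F K) c₀ W₂) : ‖DL2 F n K c₀ W w‖ ^ 2 ≤ RCLike.re ⟪w, AW w⟫_ℂ := by
  rw [hAW, re_inner_massive_eq F W QW ι TW hTW (a := a) w]
  nlinarith [sq_nonneg ‖ι (QW w)‖]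

end MassiveRows

/-! ## §2 The (RB1) row per cube -/

section RB1

variable (hnK : n < K) {ε₀ : ℝ} (hε₀ : 0 < ε₀) (hε7 : 10 ^ 7 * (F.L : ℝ) ^ 3 * ε₀ ≤ 1)
  (U₀ : GaugeField (F.P K) 0 (Matrix.specialUnitaryGroup (Fin 2) ℂ)) (hreg : RegPr F n K ε₀ U₀)
  (ι : (Site (F.P K) (K - n) → Matrix (Fin 2) (Fin 2) ℂ) →ₗ[ℂ] SiteL2K ℂ 3 (periodsT3 F n) c₁ W₂)
  (hι : ∀ c, ι c = toL2S F n c₁ (fun z => c (siteShift (sites_eq F n K h) z)))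
  {a : ℝ} (ha : 0 < a) (s : ℕ) {r : ℝ} (hr : 0 < r)
  -- per-cube letters at the cube-gauged background
  (Qc : Site (F.P K) 0 → (SiteL2K ℂ 3 (periodsT3 F K) c₀ W₂ →ₗ[ℂ] (Site (F.P K) (K - n) → Matrix (Fin 2) (Fin 2) ℂ)))
  (hseqc : ∀ c : Site (F.P K) 0, (∀ lam : Site (F.P K) 0 → Matrix (Fin 2) (Fin 2) ℂ, ∃ ns : (j : ℕ) → Site (F.P K) j → Matrix (Fin 2) (Fin 2) ℂ, ns 0 = lam ∧
        (∀ (j : ℕ) (y : Site (F.P K) (j + 1)), ns (j + 1) y = ns j (emb y) - meanCLM (Idx (F.P K)) (Matrix (Fin 2) (Fin 2) ℂ) fun i : Idx (F.P K) =>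
          ns j (emb y) - ((holT (emlIterU j (bgUnits F K (GaugeField.gaugeAct (axialT U₀ c) U₀))) (emb y) (stairWord i.2.1 (off i.1)) : (Matrix (Fin 2) (Fin 2) ℂ)ˣ) : Matrix (Fin 2) (Fin 2) ℂ) *
            ns j (transl (emb y) (disp (stairWord i.2.1 (off i.1)))) * (((holT (emlIterU j (bgUnits F K (GaugeField.gaugeAct (axialT U₀ c) U₀))) (emb y) (stairWord i.2.1 (off i.1)))⁻¹ : (Matrix (Fin 2) (Fin 2) ℂ)ˣ) : Matrix (Fin 2) (Fin 2) ℂ)) ∧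
        ns (K - n) = Qc c (toL2S F K c₀ lam)))
  (Tc : Site (F.P K) 0 → (SiteL2K ℂ 3 (periodsT3 F n) c₁ W₂ →ₗ[ℂ] SiteL2K ℂ 3 (periodsT3 F K) c₀ W₂))
  (hTc : ∀ (c : Site (F.P K) 0) (l : SiteL2K ℂ 3 (periodsT3 F K) c₀ W₂) (f : SiteL2K ℂ 3 (periodsT3 F n) c₁ W₂), ⟪ι (Qc c l), f⟫_ℂ = ⟪l, Tc c f⟫_ℂ)
  (Gc : Site (F.P K) 0 → (SiteL2K ℂ 3 (periodsT3 F K) c₀ W₂ →ₗ[ℂ] SiteL2K ℂ 3 (periodsT3 F K) c₀ W₂))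
  (hAGc : ∀ (c : Site (F.P K) 0) (f : SiteL2K ℂ 3 (periodsT3 F K) c₀ W₂), covLapSite F n K c₀ (GaugeField.gaugeAct (axialT U₀ c) U₀) (Gc c f) + (a : ℂ) • Tc c (ι (Qc c (Gc c f))) = f)
  (hGAc : ∀ (c : Site (F.P K) 0) (w : SiteL2K ℂ 3 (periodsT3 F K) c₀ W₂), Gc c (covLapSite F n K c₀ (GaugeField.gaugeAct (axialT U₀ c) U₀) w + (a : ℂ) • Tc c (ι (Qc c w))) = w)
  -- the flat system at background `1`
  (Q1 : SiteL2K ℂ 3 (periodsT3 F K) c₀ W₂ →ₗ[ℂ] (Site (F.P K) (K - n) → Matrix (Fin 2) (Fin 2) ℂ))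
  (hseq₁ : (∀ lam : Site (F.P K) 0 → Matrix (Fin 2) (Fin 2) ℂ, ∃ ns : (j : ℕ) → Site (F.P K) j → Matrix (Fin 2) (Fin 2) ℂ, ns 0 = lam ∧
        (∀ (j : ℕ) (y : Site (F.P K) (j + 1)), ns (j + 1) y = ns j (emb y) - meanCLM (Idx (F.P K)) (Matrix (Fin 2) (Fin 2) ℂ) fun i : Idx (F.P K) =>
          ns j (emb y) - ((holT (emlIterU j (bgUnits F K (1 : GaugeField (F.P K) 0 (Matrix.specialUnitaryGroup (Fin 2) ℂ)))) (emb y) (stairWord i.2.1 (off i.1)) : (Matrix (Fin 2) (Fin 2) ℂ)ˣ) : Matrix (Fin 2) (Fin 2) ℂ) *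
            ns j (transl (emb y) (disp (stairWord i.2.1 (off i.1)))) * (((holT (emlIterU j (bgUnits F K (1 : GaugeField (F.P K) 0 (Matrix.specialUnitaryGroup (Fin 2) ℂ)))) (emb y) (stairWord i.2.1 (off i.1)))⁻¹ : (Matrix (Fin 2) (Fin 2) ℂ)ˣ) : Matrix (Fin 2) (Fin 2) ℂ)) ∧
        ns (K - n) = Q1 (toL2S F K c₀ lam)))
  (T1 : SiteL2K ℂ 3 (periodsT3 F n) c₁ W₂ →ₗ[ℂ] SiteL2K ℂ 3 (periodsT3 F K) c₀ W₂) (hT1 : ∀ (l : SiteL2K ℂ 3 (periodsT3 F K) c₀ W₂) (f : SiteL2K ℂ 3 (periodsT3 F n) c₁ W₂), ⟪ι (Q1 l), f⟫_ℂ = ⟪l, T1 f⟫_ℂ)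
  (G1 : SiteL2K ℂ 3 (periodsT3 F K) c₀ W₂ →ₗ[ℂ] SiteL2K ℂ 3 (periodsT3 F K) c₀ W₂)
  (hAG1 : ∀ f, covLapSite F n K c₀ (1 : GaugeField (F.P K) 0 (Matrix.specialUnitaryGroup (Fin 2) ℂ)) (G1 f) + (a : ℂ) • T1 (ι (Q1 (G1 f))) = f)
  (hGA1 : ∀ w, G1 (covLapSite F n K c₀ (1 : GaugeField (F.P K) 0 (Matrix.specialUnitaryGroup (Fin 2) ℂ)) w + (a : ℂ) • T1 (ι (Q1 w))) = w)
  -- cut-off parameters (routeR-w2 g13's ✓`exists_cubeCutoffs`), the coarse radius, the room, the smallness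
  {ν μa Bt Bc : ℝ} (hν : 0 < ν) (hμa : 0 ≤ μa) (hBt : 1 ≤ Bt) (hBc : Bt + 1 ≤ Bc)
  (Rb : ℕ) (hRb : 3 * (F.L : ℝ) ^ s + 4 + r + Bc / ν + 3 ≤ Rb)
  (hwrap : 2 * ((Rb + 9) * F.L ^ (K - n) + 2) ≤ (F.P K).sitesPerDir 0)
  (hεRb : 24 * ε₀ * ((Rb : ℝ) + 9) ≤ 1)

include h hε₀ hε7 hreg hι ha hr hseqc hTc hAGc hGAc hseq₁ hT1 hAG1 hGA1 hν hμa hBt hBc hRb hwrap hεRb in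
/-- ★★★ **THE (RB1) ROW `hRB1` OF ✓p760402 `hloc_of_cube_rows`, AT EVERY CUBE** — `‖G_c f_c − G_1 f_c‖ ≤ cG·‖f_c‖` for `f_c = D*_{W_c}(Ad_{σ_c}X)~`, every `X` supported within
`3L^s·ℓ` of `c`; `cG` = px5's ✓`norm_massiveInv_sub_le_of_cutoff_fixed` constant at `θ := ν·η`, `θ′ := 3ν`, `δ := 2ε₀(Rb+7)`, `δV := 0`, `δU := 48ε₀(Rb+9)`,
`mU = mV := (max 2 (16c₀ℓ³∕(a c₁)))⁻¹` — `K`-free after the pin `c₁ = c₀ℓ³`; the `O(ν)` part is the cut-off commutator, the `O(ε₀·Rb)` parts the cube-gauge flatness.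
[cite: Balaban1985BackgroundPropagators, (3.24)–(3.26) pp.394–395, (3.105)–(3.106) p.414; Balaban1985RegularSpaces, Lemma 1 p.79] -/
theorem hRB1_of_cube :
    ∀ (c : Site (F.P K) 0) (X : PBond (F.P K) 0 → Matrix (Fin 2) (Fin 2) ℂ),
      (∀ b : PBond (F.P K) 0, X b ≠ 0 → Site.tdist c b.src ≤ (3 * (F.L ^ s * F.L ^ (K - n)))) →
        ‖Gc c (DstarL2 F n K c₀ (GaugeField.gaugeAct (axialT U₀ c) U₀) (toL2 F K c₀ (fun b => ((axialT U₀ c b.src : Matrix.specialUnitaryGroup (Fin 2) ℂ) : Matrix (Fin 2) (Fin 2) ℂ) * X b * star ((axialT U₀ c b.src : Matrix.specialUnitaryGroup (Fin 2) ℂ) : Matrix (Fin 2) (Fin 2) ℂ)))) - G1 (DstarL2 F n K c₀ (GaugeField.gaugeAct (axialT U₀ c) U₀) (toL2 F K c₀ (fun b => ((axialT U₀ c b.src : Matrix.specialUnitaryGroup (Fin 2) ℂ) : Matrix (Fin 2) (Fin 2) ℂ) * X b * star ((axialT U₀ c b.src : Matrix.specialUnitaryGroup (Fin 2) ℂ)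 : Matrix (Fin 2) (Fin 2) ℂ))))‖
          ≤ ((Real.sqrt (max 2 (16 * c₀ * ((F.L : ℝ) ^ (K - n)) ^ 3 / (a * c₁)))⁻¹⁻¹ * (1 + Real.sqrt (max 2 (16 * c₀ * ((F.L : ℝ) ^ (K - n)) ^ 3 / (a * c₁)))⁻¹⁻¹) * ((Real.sqrt 3 * (eta F n K)⁻¹ * (ν * eta F n K) + Real.sqrt 24 * (2 * ε₀ * ((Rb : ℝ) + 7)) + 2 * (Real.sqrt 3 * (eta F n K)⁻¹ * (ν * eta F n K)) * (Real.sqrt 24 * (2 * ε₀ * ((Rb : ℝ) + 7)))) * Real.sqrt (max 2 (16 * c₀ * ((F.L : ℝ) ^ (K - n)) ^ 3 / (a * c₁)))⁻¹⁻¹ + ((Real.sqrt 3 * (eta F n K)⁻¹ * (ν * eta F n K) + Real.sqrt 24 * (2 * ε₀ * ((Rb : ℝ) + 7)) + 2 * (Real.sqrt 3 * (eta F n K)⁻¹ * (ν * eta F n K)) * (Real.sqrt 24 * (2 * ε₀ * ((Rb : ℝ) + 7)))) + a * ((25 / 4) * (c₁ * ((((F.P K).L : ℝ) ^ (F.P K).d)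 ^ (K - n))⁻¹ / c₀) * (3 * ν) + 2 * Real.sqrt ((25 / 8) * (c₁ * ((((F.P K).L : ℝ) ^ (F.P K).d) ^ (K - n))⁻¹ / c₀)) * (Real.sqrt (2 * (c₁ * ((((F.P K).L : ℝ) ^ (F.P K).d) ^ (K - n))⁻¹ / c₀)) * (2 * (4500 * (F.L : ℝ) ^ 2 * ε₀) + 2 * 0 + 2 * (48 * ε₀ * ((Rb : ℝ) + 9)))))) * (max 2 (16 * c₀ * ((F.L : ℝ) ^ (K - n)) ^ 3 / (a * c₁)))⁻¹⁻¹)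
          + Real.sqrt (max 2 (16 * c₀ * ((F.L : ℝ) ^ (K - n)) ^ 3 / (a * c₁)))⁻¹⁻¹ * (1 + Real.sqrt (max 2 (16 * c₀ * ((F.L : ℝ) ^ (K - n)) ^ 3 / (a * c₁)))⁻¹⁻¹) * ((Real.sqrt 3 * (eta F n K)⁻¹ * (ν * eta F n K) + Real.sqrt 24 * (2 * ε₀ * ((Rb : ℝ) + 7)) + 2 * (Real.sqrt 3 * (eta F n K)⁻¹ * (ν * eta F n K)) * (Real.sqrt 24 * (2 * ε₀ * ((Rb : ℝ) + 7)))) * Real.sqrt (max 2 (16 * c₀ * ((F.L : ℝ) ^ (K - n)) ^ 3 / (a * c₁)))⁻¹⁻¹ + ((Real.sqrt 3 * (eta F n K)⁻¹ * (ν * eta F n K) + Real.sqrt 24 * (2 * ε₀ * ((Rb : ℝ) + 7)) + 2 * (Real.sqrt 3 * (eta F n K)⁻¹ * (ν * eta F n K)) * (Real.sqrt 24 * (2 * ε₀ * ((Rb : ℝ) + 7)))) + a * ((25 / 4) * (c₁ * ((((F.P K).L : ℝ) ^ (F.P K).d) ^ (K - n))⁻¹ / c₀) * (3 * ν) + 2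 * Real.sqrt ((25 / 8) * (c₁ * ((((F.P K).L : ℝ) ^ (F.P K).d) ^ (K - n))⁻¹ / c₀)) * 0)) * (max 2 (16 * c₀ * ((F.L : ℝ) ^ (K - n)) ^ 3 / (a * c₁)))⁻¹⁻¹))) * ‖DstarL2 F n K c₀ (GaugeField.gaugeAct (axialT U₀ c) U₀) (toL2 F K c₀ (fun b => ((axialT U₀ c b.src : Matrix.specialUnitaryGroup (Fin 2) ℂ) : Matrix (Fin 2) (Fin 2) ℂ) * X b * star ((axialT U₀ c b.src : Matrix.specialUnitaryGroup (Fin 2) ℂ) : Matrix (Fin 2) (Fin 2) ℂ)))‖ := by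
  intro c X hX
  classical
  have hc₀ : 0 < c₀ := Fact.out
  have hc₁ : 0 < c₁ := Fact.out
  have hη := eta_pos F n K
  have hL1 : 1 ≤ F.L ^ (K - n) := Nat.one_le_pow _ _ (by have := F.hL.2; omega)
  -- the two backgrounds are regular
  have hregW : RegPr F n K ε₀ (GaugeField.gaugeAct (axialT U₀ c) U₀) := (regPr_gaugeAct_iff F hε₀.le (axialT U₀ c) U₀).mpr hreg
  have hreg1 : RegPr F n K ε₀ (1 : GaugeField (F.P K) 0 (Matrix.specialUnitaryGroup (Fin 2) ℂ)) := regPr_one (F := F) (n := n) (K := K) hε₀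
  -- the coarse neighbourhood `T₀` of the cube and its cut-offs
  set S : Finset (Site (F.P K) (K - n)) := Finset.univ.filter fun z : Site (F.P K) (K - n) => Site.tdist z (iterBlockOf (K - n) c) ≤ 3 * F.L ^ s + 4 with hS
  set T₀ : Finset (Site (F.P K) (K - n)) := Finset.univ.filter fun z : Site (F.P K) (K - n) => ∃ z' ∈ S, (Site.tdist (P := F.P K) z' z : ℝ) < r with hT₀
  have hST : ∀ z ∈ S, z ∈ T₀ := fun z hz => by
    rw [hT₀, Finset.mem_filter]
    refine ⟨Finset.mem_univ _, z, hz, ?_⟩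
    rw [tdist_self]; exact_mod_cast hr
  have hcS : iterBlockOf (K - n) c ∈ S := by
    rw [hS, Finset.mem_filter]; exact ⟨Finset.mem_univ _, by rw [tdist_self]; exact Nat.zero_le _⟩
  have hT₀ne : T₀.Nonempty := ⟨_, hST _ hcS⟩
  obtain ⟨χ, χt, χc, φ, φc, h1, h2, h3, h4, h5, h6, h7, h8, h9, h10, h11, h12⟩ := exists_cubeCutoffs F h T₀ hT₀ne hν hμa hBt hBc
  -- the fine radius of `supp χ`
  have hRT : ∀ y ∈ T₀, (Site.tdist (iterBlockOf (K - n) c) y : ℝ) ≤ 3 * (F.L : ℝ) ^ s + 4 + r := fun y hy => by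
    rw [hT₀] at hy
    exact tdist_blocks_T₀_le F c s r y (Finset.mem_filter.mp hy).2
  have hR : ∀ x, χ x ≠ 0 → Site.tdist c x ≤ (Rb + 6) * F.L ^ (K - n) := by
    intro x hx
    have hreal := tdist_le_of_cutoff_row F h c T₀ hRT χ h12 x hx
    have hℓ : (1 : ℝ) ≤ (F.L : ℝ) ^ (K - n) := by exact_mod_cast hL1
    have hℓ0 : (0 : ℝ) ≤ (F.L : ℝ) ^ (K - n) := by positivity
    have hbd : (F.L : ℝ) ^ (K - n) * (3 * (F.L : ℝ) ^ s + 4 + r + Bc / ν + 3) + 6 * ((F.L : ℝ) ^ (K - n) - 1) ≤ (((Rb + 6) * F.L ^ (K - n) : ℕ) : ℝ) := by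
      push_cast
      nlinarith [mul_le_mul_of_nonneg_left hRb hℓ0]
    exact_mod_cast hreal.trans hbd
  have hwrap' : 2 * ((Rb + 6) * F.L ^ (K - n) + 3 * (F.L ^ (K - n) - 1) + 2) ≤ (F.P K).sitesPerDir 0 := by
    have h3 : 3 * (F.L ^ (K - n) - 1) ≤ 3 * F.L ^ (K - n) := Nat.mul_le_mul_left _ (Nat.sub_le _ _)
    have : (Rb + 6) * F.L ^ (K - n) + 3 * (F.L ^ (K - n) - 1) + 2 ≤ (Rb + 9) * F.L ^ (K - n) + 2 := by nlinarith
    omega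
  have hRreal : (((Rb + 6) * F.L ^ (K - n) : ℕ) : ℝ) ≤ (F.L : ℝ) ^ (K - n) * ((Rb : ℝ) + 6) := by push_cast; nlinarith
  -- flatness letters of the cube-gauged background on `supp χ` (STAGE G)
  have hUV : ∀ b : PBond (F.P K) 0, (χ b.tgt ≠ 0 ∨ χ b.src ≠ 0) →
      ‖((bgUnits F K (GaugeField.gaugeAct (axialT U₀ c) U₀) b : (Matrix (Fin 2) (Fin 2) ℂ)ˣ) : Matrix (Fin 2) (Fin 2) ℂ) - ((bgUnits F K (1 : GaugeField (F.P K) 0 (Matrix.specialUnitaryGroup (Fin 2) ℂ)) b : (Matrix (Fin 2) (Fin 2) ℂ)ˣ) : Matrix (Fin 2) (Fin 2) ℂ)‖ ≤ (2 * ε₀ * ((Rb : ℝ) + 7)) * eta F n K := by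
    intro b hb
    refine (hUV_cubeGauge F hε₀ U₀ hreg c χ hR hwrap' b hb).trans (mul_le_mul_of_nonneg_right ?_ hη.le)
    have := delta_le_of_radius_le F (n := n) (K := K) hε₀ (R := (Rb + 6) * F.L ^ (K - n)) (R' := (Rb : ℝ) + 6) hRreal
    linarith
  have hδ'le : 2 * regThreshold F n K ε₀ * (((((Rb + 6) * F.L ^ (K - n) : ℕ) : ℝ)) + 3 * ((F.L : ℝ) ^ (K - n) - 1)) ≤ 2 * ε₀ * eta F n K * ((Rb : ℝ) + 9) := by
    have := deltaFlat_le_of_radius_le F (n := n) (K := K) hε₀ (R := (Rb + 6) * F.L ^ (K - n)) (R' := (Rb : ℝ) + 6) hRreal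
    linarith
  have hflat := hflat_cubeGauge F hε₀ U₀ hreg c χ hR hwrap'
  -- the comb frames: `m = max 1 (3(ℓ−1)) ≤ 3ℓ`, `4mδ′ ≤ 24ε₀(Rb+9) ≤ 1`, frames within `8mδ′ ≤ 48ε₀(Rb+9)` of `1`
  have hm1 := one_le_frameWalkBound F (n := n) (K := K)
  have hmreal : (((max 1 ((F.P K).d * ((F.P K).L ^ (K - n) - 1))) : ℕ) : ℝ) ≤ 3 * (F.L : ℝ) ^ (K - n) := by
    have hd : (F.P K).d = 3 := rfl
    have hL : (F.P K).L = F.L := rfl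
    rw [hd, hL]
    have : max 1 (3 * (F.L ^ (K - n) - 1)) ≤ 3 * F.L ^ (K - n) := max_le (by omega) (Nat.mul_le_mul_left _ (Nat.sub_le _ _))
    exact_mod_cast this
  have hδ'0 : 0 ≤ 2 * regThreshold F n K ε₀ * (((((Rb + 6) * F.L ^ (K - n) : ℕ) : ℝ)) + 3 * ((F.L : ℝ) ^ (K - n) - 1)) := by
    have := regThreshold_pos F (n := n) (K := K) hε₀
    have hℓ : (1 : ℝ) ≤ (F.L : ℝ) ^ (K - n) := by exact_mod_cast hL1
    have : (0 : ℝ) ≤ (F.L : ℝ) ^ (K - n) - 1 := by linarith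
    positivity
  have hone := eta_mul_pow_eq_one F (n := n) (K := K)
  have h8m : 8 * (((max 1 ((F.P K).d * ((F.P K).L ^ (K - n) - 1))) : ℕ) : ℝ) * (2 * regThreshold F n K ε₀ * (((((Rb + 6) * F.L ^ (K - n) : ℕ) : ℝ)) + 3 * ((F.L : ℝ) ^ (K - n) - 1)))
      ≤ 48 * ε₀ * ((Rb : ℝ) + 9) := by
    calc 8 * (((max 1 ((F.P K).d * ((F.P K).L ^ (K - n) - 1))) : ℕ) : ℝ) * (2 * regThreshold F n K ε₀ * (((((Rb + 6) * F.L ^ (K - n) : ℕ) : ℝ)) + 3 * ((F.L : ℝ) ^ (K - n) - 1)))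
        ≤ 8 * (3 * (F.L : ℝ) ^ (K - n)) * (2 * ε₀ * eta F n K * ((Rb : ℝ) + 9)) :=
          mul_le_mul (mul_le_mul_of_nonneg_left hmreal (by norm_num)) hδ'le hδ'0 (by positivity)
      _ = 48 * ε₀ * ((Rb : ℝ) + 9) * (eta F n K * (F.L : ℝ) ^ (K - n)) := by ring
      _ = 48 * ε₀ * ((Rb : ℝ) + 9) := by rw [hone, mul_one]
  have hmδ : 4 * (((max 1 ((F.P K).d * ((F.P K).L ^ (K - n) - 1))) : ℕ) : ℝ) * (2 * regThreshold F n K ε₀ * (((((Rb + 6) * F.L ^ (K - n) : ℕ) : ℝ)) + 3 * ((F.L : ℝ) ^ (K - n) - 1))) ≤ 1 := by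
    have hm0' : (0:ℝ) ≤ (((max 1 ((F.P K).d * ((F.P K).L ^ (K - n) - 1))) : ℕ) : ℝ) := Nat.cast_nonneg _
    nlinarith [h8m, hεRb, hδ'0, hm0']
  have hCU := frameRow_of_walkFlat F (GaugeField.gaugeAct (axialT U₀ c) U₀) χ hδ'0 hm1 hmδ (frameWalkLengths F χ) (walkFlat_of_blockFlat F (GaugeField.gaugeAct (axialT U₀ c) U₀) χ hflat)
  have hflat1 : ∀ Y : Site (F.P K) (K - n), (∃ x ∈ iterBlock (K - n) Y, χ x ≠ 0) → ∀ b : PBond (F.P K) 0,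
      iterBlockOf (K - n) b.src = Y → iterBlockOf (K - n) b.tgt = Y → ‖((bgUnits F K (1 : GaugeField (F.P K) 0 (Matrix.specialUnitaryGroup (Fin 2) ℂ)) b : (Matrix (Fin 2) (Fin 2) ℂ)ˣ) : Matrix (Fin 2) (Fin 2) ℂ) - 1‖ ≤ 0 := by
    intro Y _ b _ _
    rw [bgUnits_one]; simp
  have hm0 : 4 * (((max 1 ((F.P K).d * ((F.P K).L ^ (K - n) - 1))) : ℕ) : ℝ) * (0 : ℝ) ≤ 1 := by norm_num
  have hCV := frameRow_of_walkFlat F (1 : GaugeField (F.P K) 0 (Matrix.specialUnitaryGroup (Fin 2) ℂ)) χ le_rfl hm1 hm0 (frameWalkLengths F χ) (walkFlat_of_blockFlat F (1 : GaugeField (F.P K) 0 (Matrix.specialUnitaryGroup (Fin 2) ℂ)) χ hflat1)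
  -- the massive operators
  let AU : SiteL2K ℂ 3 (periodsT3 F K) c₀ W₂ →ₗ[ℂ] SiteL2K ℂ 3 (periodsT3 F K) c₀ W₂ := covLapSite F n K c₀ (GaugeField.gaugeAct (axialT U₀ c) U₀) + (a : ℂ) • (Tc c ∘ₗ ι ∘ₗ Qc c)
  have hAU : ∀ w, AU w = covLapSite F n K c₀ (GaugeField.gaugeAct (axialT U₀ c) U₀) w + (a : ℂ) • Tc c (ι (Qc c w)) := fun w => rfl
  let AV : SiteL2K ℂ 3 (periodsT3 F K) c₀ W₂ →ₗ[ℂ] SiteL2K ℂ 3 (periodsT3 F K) c₀ W₂ := covLapSite F n K c₀ (1 : GaugeField (F.P K) 0 (Matrix.specialUnitaryGroup (Fin 2) ℂ)) + (a : ℂ) • (T1 ∘ₗ ι ∘ₗ Q1)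
  have hAV : ∀ w, AV w = covLapSite F n K c₀ (1 : GaugeField (F.P K) 0 (Matrix.specialUnitaryGroup (Fin 2) ℂ)) w + (a : ℂ) • T1 (ι (Q1 w)) := fun w => rfl
  have hUG : ∀ v, AU (Gc c v) = v := fun v => by rw [hAU]; exact hAGc c v
  have hGA : ∀ v, Gc c (AU v) = v := fun v => by rw [hAU]; exact hGAc c v
  have hAG : ∀ v, AV (G1 v) = v := fun v => by rw [hAV]; exact hAG1 v
  have hGAV : ∀ v, G1 (AV v) = v := fun v => by rw [hAV]; exact hGA1 v
  have hmU : (0 : ℝ) < (max 2 (16 * c₀ * ((F.L : ℝ) ^ (K - n)) ^ 3 / (a * c₁)))⁻¹ := inv_pos.mpr (lt_of_lt_of_le (by norm_num) (le_max_left _ _))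
  have hcoU := coercive_of_massive F h hε₀ hε7 (GaugeField.gaugeAct (axialT U₀ c) U₀) hregW (Qc c) (hseqc c) ι hι (Tc c) (hTc c) ha AU hAU
  have hcoV := coercive_of_massive F h hε₀ hε7 (1 : GaugeField (F.P K) 0 (Matrix.specialUnitaryGroup (Fin 2) ℂ)) hreg1 Q1 hseq₁ ι hι T1 hT1 ha AV hAV
  have henergyU := energy_of_massive F (GaugeField.gaugeAct (axialT U₀ c) U₀) (Qc c) ι (Tc c) (hTc c) AU hAU ha.le
  have henergyV := energy_of_massive F (1 : GaugeField (F.P K) 0 (Matrix.specialUnitaryGroup (Fin 2) ℂ)) Q1 ι T1 hT1 AV hAV ha.le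
  -- the cut-off operator and its plateau on the `D*` support
  obtain ⟨Xop, hXop⟩ := exists_siteMul F (K := K) (c₀ := c₀) χ
  set f : SiteL2K ℂ 3 (periodsT3 F K) c₀ W₂ := DstarL2 F n K c₀ (GaugeField.gaugeAct (axialT U₀ c) U₀) (toL2 F K c₀ (fun b => ((axialT U₀ c b.src : Matrix.specialUnitaryGroup (Fin 2) ℂ) : Matrix (Fin 2) (Fin 2) ℂ) * X b * star ((axialT U₀ c b.src : Matrix.specialUnitaryGroup (Fin 2) ℂ) : Matrix (Fin 2) (Fin 2) ℂ))) with hf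
  have hXf : Xop f = f := by
    have hfu : toL2S F K c₀ ((toL2S F K c₀).symm f) = f := (toL2S F K c₀).apply_symm_apply f
    rw [← hfu, hXop]
    congr 1
    funext x
    by_cases hx0 : (toL2S F K c₀).symm f x = 0
    · rw [hx0, smul_zero]
    · have hxS : iterBlockOf (K - n) x ∈ S := by
        by_contra hnot
        exact hx0 (dstar_blockSupport F (n := n) (c₀ := c₀) (GaugeField.gaugeAct (axialT U₀ c) U₀)
          (fun b => ((axialT U₀ c b.src : Matrix.specialUnitaryGroup (Fin 2) ℂ) : Matrix (Fin 2) (Fin 2) ℂ) * X b * star ((axialT U₀ c b.src : Matrix.specialUnitaryGroup (Fin 2) ℂ) : Matrix (Fin 2) (Fin 2) ℂ))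
          c s (fun b hb => hX b (fun hXb => hb (by rw [hXb, mul_zero, zero_mul]))) x (by rw [← hS]; exact hnot))
      rw [(h7 x (hST _ hxS)).1, one_smul]
  -- px5's dock
  have key := norm_massiveInv_sub_le_of_cutoff_fixed F h hε₀ hε7 (1 : GaugeField (F.P K) 0 (Matrix.specialUnitaryGroup (Fin 2) ℂ)) hreg1 Q1 hseq₁ ι hι T1 hT1 (GaugeField.gaugeAct (axialT U₀ c) U₀) hregW (Qc c) (hseqc c) (Tc c) (hTc c)
    χ χc (θ := ν * eta F n K) (θ' := 3 * ν) (δ := 2 * ε₀ * ((Rb : ℝ) + 7)) (by positivity) (by positivity) (by positivity) h1 h2 h3 hUV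
    (δV := 0) (δU := 48 * ε₀ * ((Rb : ℝ) + 9)) le_rfl (by positivity)
    (fun Y hY x hx => (hCV Y hY x hx).trans (by simp))
    (fun Y hY x hx => (hCU Y hY x hx).trans h8m)
    ha.le Xop hXop AU AV (Gc c) G1 hAV hAU hUG hAG hGA hGAV hmU hmU hcoU hcoV henergyU henergyV f hXf
  exact key

include h hε₀ hε7 hreg hι ha hr hseqc hseq₁ hT1 hAG1 hν hμa hBt hBc hRb hwrap hεRb in
/-- ★★★ **THE (RB2) ROW `hRB2` OF ✓p760402 `hloc_of_cube_rows`, AT EVERY CUBE** — `‖ι(Q_c(G_1 f_c)) − ι(Q_1(G_1 f_c))‖ ≤ cQ·‖f_c‖`, from px5's dock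
✓`norm_lift_topMean_sub_flat_propagated_le` at the plateau cut-off `χt`, Agmon weight `φ` (`θ := μa·η`, `θ′ := 3μa`, `R := μa(Bt−1)∕ν`), block flatness `δ′`, `‖G_1‖ ≤ C_P²`
(✓`norm_le_of_massive_eq`), with the WINDOW `hδw`∕`hwin` at slope `μa` DISPLAYED (routeR-w4 g27's δP-letters close it), and
`cQ := √(2κ)·(9000L²ε₀ + 96ε₀(Rb+9))·C_P² + 2√(25κ∕8)·e^{−μa(Bt−1)∕ν}·64C_P²`, `κ = c₁∕(c₀ℓ³)` — `K`-free after the pin.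
[cite: Balaban1985BackgroundPropagators, (3.19) p.393, (3.24) p.394, (3.49) p.399, (3.105)–(3.106) p.414; Balaban1985Averaging, (97) p.32] -/
theorem hRB2_of_cube {δ₁ : ℝ} (hδ₁ : 0 ≤ δ₁)
    (hδw : 3 * ((eta F n K)⁻¹) ^ 2 * (Real.exp (μa * eta F n K) - 1) ^ 2 + a * ((25 / 8) * (c₁ * ((((F.P K).L : ℝ) ^ (F.P K).d) ^ (K - n))⁻¹ / c₀)) * (Real.exp (3 * μa) - 1) ^ 2 ≤ δ₁ ^ 2)
    (hwin : Real.sqrt (max 2 (16 * c₀ * ((F.L : ℝ) ^ (K - n)) ^ 3 / (a * c₁))) * δ₁ ≤ 1 / 10) :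
    ∀ (c : Site (F.P K) 0) (X : PBond (F.P K) 0 → Matrix (Fin 2) (Fin 2) ℂ),
      (∀ b : PBond (F.P K) 0, X b ≠ 0 → Site.tdist c b.src ≤ (3 * (F.L ^ s * F.L ^ (K - n)))) →
        ‖ι (Qc c (G1 (DstarL2 F n K c₀ (GaugeField.gaugeAct (axialT U₀ c) U₀) (toL2 F K c₀ (fun b => ((axialT U₀ c b.src : Matrix.specialUnitaryGroup (Fin 2) ℂ) : Matrix (Fin 2) (Fin 2) ℂ) * X b * star ((axialT U₀ c b.src : Matrix.specialUnitaryGroup (Fin 2) ℂ) : Matrix (Fin 2) (Fin 2) ℂ)))))) - ι (Q1 (G1 (DstarL2 F n K c₀ (GaugeField.gaugeAct (axialT U₀ c) U₀) (toL2 F K c₀ (fun b => ((axialT U₀ c b.src : Matrix.specialUnitaryGroup (Fin 2) ℂ) : Matrix (Fin 2) (Fin 2) ℂ) * X b * star ((axialT U₀ c b.src : Matrix.specialUnitaryGroup (Fin 2) ℂ) : Matrix (Fin 2) (Fin 2) ℂ))))))‖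
          ≤ (Real.sqrt (2 * (c₁ * ((((F.P K).L : ℝ) ^ (F.P K).d) ^ (K - n))⁻¹ / c₀)) * (2 * (4500 * (F.L : ℝ) ^ 2 * ε₀) + 96 * ε₀ * ((Rb : ℝ) + 9)) * (max 2 (16 * c₀ * ((F.L : ℝ) ^ (K - n)) ^ 3 / (a * c₁)))
          + 2 * Real.sqrt ((25 / 8) * (c₁ * ((((F.P K).L : ℝ) ^ (F.P K).d) ^ (K - n))⁻¹ / c₀)) * (Real.exp (-(μa * ((Bt - 1) / ν))) * (8 * Real.sqrt (max 2 (16 * c₀ * ((F.L : ℝ) ^ (K - n)) ^ 3 / (a * c₁))) ^ 2))) * ‖DstarL2 F n K c₀ (GaugeField.gaugeAct (axialT U₀ c) U₀) (toL2 F K c₀ (fun b => ((axialT U₀ c b.src : Matrix.specialUnitaryGroup (Fin 2) ℂ) : Matrix (Fin 2) (Fin 2) ℂ) * X b * star ((axialT U₀ c b.src : Matrix.specialUnitaryGroup (Fin 2) ℂ) : Matrix (Fin 2) (Fin 2) ℂ)))‖ := by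
  intro c X hX
  classical
  have hc₀ : 0 < c₀ := Fact.out
  have hc₁ : 0 < c₁ := Fact.out
  have hη := eta_pos F n K
  have hL1 : 1 ≤ F.L ^ (K - n) := Nat.one_le_pow _ _ (by have := F.hL.2; omega)
  -- the two backgrounds are regular
  have hregW : RegPr F n K ε₀ (GaugeField.gaugeAct (axialT U₀ c) U₀) := (regPr_gaugeAct_iff F hε₀.le (axialT U₀ c) U₀).mpr hreg
  have hreg1 : RegPr F n K ε₀ (1 : GaugeField (F.P K) 0 (Matrix.specialUnitaryGroup (Fin 2) ℂ)) := regPr_one (F := F) (n := n) (K := K) hε₀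
  -- the coarse neighbourhood `T₀` of the cube and its cut-offs
  set S : Finset (Site (F.P K) (K - n)) := Finset.univ.filter fun z : Site (F.P K) (K - n) => Site.tdist z (iterBlockOf (K - n) c) ≤ 3 * F.L ^ s + 4 with hS
  set T₀ : Finset (Site (F.P K) (K - n)) := Finset.univ.filter fun z : Site (F.P K) (K - n) => ∃ z' ∈ S, (Site.tdist (P := F.P K) z' z : ℝ) < r with hT₀
  have hST : ∀ z ∈ S, z ∈ T₀ := fun z hz => by
    rw [hT₀, Finset.mem_filter]
    refine ⟨Finset.mem_univ _, z, hz, ?_⟩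
    rw [tdist_self]; exact_mod_cast hr
  have hcS : iterBlockOf (K - n) c ∈ S := by
    rw [hS, Finset.mem_filter]; exact ⟨Finset.mem_univ _, by rw [tdist_self]; exact Nat.zero_le _⟩
  have hT₀ne : T₀.Nonempty := ⟨_, hST _ hcS⟩
  obtain ⟨χ, χt, χc, φ, φc, h1, h2, h3, h4, h5, h6, h7, h8, h9, h10, h11, h12⟩ := exists_cubeCutoffs F h T₀ hT₀ne hν hμa hBt hBc
  -- the fine radius of `supp χ`
  have hRT : ∀ y ∈ T₀, (Site.tdist (iterBlockOf (K - n) c) y : ℝ) ≤ 3 * (F.L : ℝ) ^ s + 4 + r := fun y hy => by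
    rw [hT₀] at hy
    exact tdist_blocks_T₀_le F c s r y (Finset.mem_filter.mp hy).2
  have hR : ∀ x, χ x ≠ 0 → Site.tdist c x ≤ (Rb + 6) * F.L ^ (K - n) := by
    intro x hx
    have hreal := tdist_le_of_cutoff_row F h c T₀ hRT χ h12 x hx
    have hℓ : (1 : ℝ) ≤ (F.L : ℝ) ^ (K - n) := by exact_mod_cast hL1
    have hℓ0 : (0 : ℝ) ≤ (F.L : ℝ) ^ (K - n) := by positivity
    have hbd : (F.L : ℝ) ^ (K - n) * (3 * (F.L : ℝ) ^ s + 4 + r + Bc / ν + 3) + 6 * ((F.L : ℝ) ^ (K - n) - 1) ≤ (((Rb + 6) * F.L ^ (K - n) : ℕ) : ℝ) := by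
      push_cast
      nlinarith [mul_le_mul_of_nonneg_left hRb hℓ0]
    exact_mod_cast hreal.trans hbd
  have hwrap' : 2 * ((Rb + 6) * F.L ^ (K - n) + 3 * (F.L ^ (K - n) - 1) + 2) ≤ (F.P K).sitesPerDir 0 := by
    have h3 : 3 * (F.L ^ (K - n) - 1) ≤ 3 * F.L ^ (K - n) := Nat.mul_le_mul_left _ (Nat.sub_le _ _)
    have : (Rb + 6) * F.L ^ (K - n) + 3 * (F.L ^ (K - n) - 1) + 2 ≤ (Rb + 9) * F.L ^ (K - n) + 2 := by nlinarith
    omega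
  have hRreal : (((Rb + 6) * F.L ^ (K - n) : ℕ) : ℝ) ≤ (F.L : ℝ) ^ (K - n) * ((Rb : ℝ) + 6) := by push_cast; nlinarith
  -- block flatness on the plateau cut-off's blocks (STAGE G, row (6))
  have hδ'le : 2 * regThreshold F n K ε₀ * (((((Rb + 6) * F.L ^ (K - n) : ℕ) : ℝ)) + 3 * ((F.L : ℝ) ^ (K - n) - 1)) ≤ 2 * ε₀ * eta F n K * ((Rb : ℝ) + 9) := by
    have := deltaFlat_le_of_radius_le F (n := n) (K := K) hε₀ (R := (Rb + 6) * F.L ^ (K - n)) (R' := (Rb : ℝ) + 6) hRreal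
    linarith
  have hflat_t := hflat_cubeGauge_of_plateau F hε₀ U₀ hreg c χ hwrap' hR χt h6
  -- the comb frames on `supp χt`
  have hm1 := one_le_frameWalkBound F (n := n) (K := K)
  have hmreal : (((max 1 ((F.P K).d * ((F.P K).L ^ (K - n) - 1))) : ℕ) : ℝ) ≤ 3 * (F.L : ℝ) ^ (K - n) := by
    have hd : (F.P K).d = 3 := rfl
    have hL : (F.P K).L = F.L := rfl
    rw [hd, hL]
    have : max 1 (3 * (F.L ^ (K - n) - 1)) ≤ 3 * F.L ^ (K - n) := max_le (by omega) (Nat.mul_le_mul_left _ (Nat.sub_le _ _))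
    exact_mod_cast this
  have hδ'0 : 0 ≤ 2 * regThreshold F n K ε₀ * (((((Rb + 6) * F.L ^ (K - n) : ℕ) : ℝ)) + 3 * ((F.L : ℝ) ^ (K - n) - 1)) := by
    have := regThreshold_pos F (n := n) (K := K) hε₀
    have hℓ : (1 : ℝ) ≤ (F.L : ℝ) ^ (K - n) := by exact_mod_cast hL1
    have : (0 : ℝ) ≤ (F.L : ℝ) ^ (K - n) - 1 := by linarith
    positivity
  have hone := eta_mul_pow_eq_one F (n := n) (K := K)
  have h8m : 8 * (((max 1 ((F.P K).d * ((F.P K).L ^ (K - n) - 1))) : ℕ) : ℝ) * (2 * regThreshold F n K ε₀ * (((((Rb + 6) * F.L ^ (K - n) : ℕ) : ℝ)) + 3 * ((F.L : ℝ) ^ (K - n) - 1)))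
      ≤ 48 * ε₀ * ((Rb : ℝ) + 9) := by
    calc 8 * (((max 1 ((F.P K).d * ((F.P K).L ^ (K - n) - 1))) : ℕ) : ℝ) * (2 * regThreshold F n K ε₀ * (((((Rb + 6) * F.L ^ (K - n) : ℕ) : ℝ)) + 3 * ((F.L : ℝ) ^ (K - n) - 1)))
        ≤ 8 * (3 * (F.L : ℝ) ^ (K - n)) * (2 * ε₀ * eta F n K * ((Rb : ℝ) + 9)) :=
          mul_le_mul (mul_le_mul_of_nonneg_left hmreal (by norm_num)) hδ'le hδ'0 (by positivity)
      _ = 48 * ε₀ * ((Rb : ℝ) + 9) * (eta F n K * (F.L : ℝ) ^ (K - n)) := by ring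
      _ = 48 * ε₀ * ((Rb : ℝ) + 9) := by rw [hone, mul_one]
  have hm0' : (0 : ℝ) ≤ (((max 1 ((F.P K).d * ((F.P K).L ^ (K - n) - 1))) : ℕ) : ℝ) := Nat.cast_nonneg _
  have hmδ : 4 * (((max 1 ((F.P K).d * ((F.P K).L ^ (K - n) - 1))) : ℕ) : ℝ) * (2 * regThreshold F n K ε₀ * (((((Rb + 6) * F.L ^ (K - n) : ℕ) : ℝ)) + 3 * ((F.L : ℝ) ^ (K - n) - 1))) ≤ 1 := by
    nlinarith [h8m, hεRb, hδ'0, hm0']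
  have hlen := frameWalkLengths F (n := n) (K := K) χt
  have hw := walkFlat_of_blockFlat F (n := n) (GaugeField.gaugeAct (axialT U₀ c) U₀) χt hflat_t
  -- the flat massive operator and the bound `‖G_1‖ ≤ C_P²`
  let AV : SiteL2K ℂ 3 (periodsT3 F K) c₀ W₂ →ₗ[ℂ] SiteL2K ℂ 3 (periodsT3 F K) c₀ W₂ := covLapSite F n K c₀ (1 : GaugeField (F.P K) 0 (Matrix.specialUnitaryGroup (Fin 2) ℂ)) + (a : ℂ) • (T1 ∘ₗ ι ∘ₗ Q1)
  have hAV : ∀ w, AV w = covLapSite F n K c₀ (1 : GaugeField (F.P K) 0 (Matrix.specialUnitaryGroup (Fin 2) ℂ)) w + (a : ℂ) • T1 (ι (Q1 w)) := fun w => rfl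
  set f : SiteL2K ℂ 3 (periodsT3 F K) c₀ W₂ := DstarL2 F n K c₀ (GaugeField.gaugeAct (axialT U₀ c) U₀) (toL2 F K c₀ (fun b => ((axialT U₀ c b.src : Matrix.specialUnitaryGroup (Fin 2) ℂ) : Matrix (Fin 2) (Fin 2) ℂ) * X b * star ((axialT U₀ c b.src : Matrix.specialUnitaryGroup (Fin 2) ℂ) : Matrix (Fin 2) (Fin 2) ℂ))) with hf
  have hAGf : AV (G1 f) = f := by rw [hAV]; exact hAG1 f
  have hG1f : ‖G1 f‖ ≤ (max 2 (16 * c₀ * ((F.L : ℝ) ^ (K - n)) ^ 3 / (a * c₁))) * ‖f‖ := norm_le_of_massive_eq F h hε₀ hε7 (1 : GaugeField (F.P K) 0 (Matrix.specialUnitaryGroup (Fin 2) ℂ)) hreg1 Q1 hseq₁ ι hι T1 hT1 ha (G1 f) f (hAG1 f)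
  -- `φ = 0` on the `D*` support (row (7), `S_c ⊆ T₀`)
  have hφf : ∀ x, (toL2S F K c₀).symm f x ≠ 0 → φ x = 0 := by
    intro x hx0
    have hxS : iterBlockOf (K - n) x ∈ S := by
      by_contra hnot
      exact hx0 (dstar_blockSupport F (n := n) (c₀ := c₀) (GaugeField.gaugeAct (axialT U₀ c) U₀)
        (fun b => ((axialT U₀ c b.src : Matrix.specialUnitaryGroup (Fin 2) ℂ) : Matrix (Fin 2) (Fin 2) ℂ) * X b * star ((axialT U₀ c b.src : Matrix.specialUnitaryGroup (Fin 2) ℂ) : Matrix (Fin 2) (Fin 2) ℂ))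
        c s (fun b hb => hX b (fun hXb => hb (by rw [hXb, mul_zero, zero_mul]))) x (by rw [← hS]; exact hnot))
    exact (h7 x (hST _ hxS)).2.2
  -- px5's dock
  have key := norm_lift_topMean_sub_flat_propagated_le F h hε₀ hε7 hreg1 Q1 hseq₁ ι hι T1 hT1 (GaugeField.gaugeAct (axialT U₀ c) U₀) hregW (Qc c) (hseqc c) ha
    χt h4 h5 hδ'0 hm1 hmδ hlen hw φ φc (θ := μa * eta F n K) (θ' := 3 * μa) (by positivity) h8 h9 hδ₁ hδw hwin
    (R := μa * ((Bt - 1) / ν)) h11 AV G1 hAV f hAGf hG1f hφf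
  have hκ0 : 0 ≤ Real.sqrt (2 * (c₁ * ((((F.P K).L : ℝ) ^ (F.P K).d) ^ (K - n))⁻¹ / c₀)) := Real.sqrt_nonneg _
  have hC0 : (0 : ℝ) ≤ (max 2 (16 * c₀ * ((F.L : ℝ) ^ (K - n)) ^ 3 / (a * c₁))) := le_trans (by norm_num) (le_max_left _ _)
  have h16 : 16 * (((max 1 ((F.P K).d * ((F.P K).L ^ (K - n) - 1))) : ℕ) : ℝ) * (2 * regThreshold F n K ε₀ * (((((Rb + 6) * F.L ^ (K - n) : ℕ) : ℝ)) + 3 * ((F.L : ℝ) ^ (K - n) - 1)))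
      ≤ 96 * ε₀ * ((Rb : ℝ) + 9) := by linarith
  exact key.trans (mul_le_mul_of_nonneg_right (add_le_add (mul_le_mul_of_nonneg_right
    (mul_le_mul_of_nonneg_left (by linarith) hκ0) hC0) le_rfl) (norm_nonneg _))

end RB1

end Summit.QuantumFields.YangMills.Theorems.Prop7LocalProjectorRowsRBOfCube

end
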